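import Mathlib
import HarnessLib
import Summits.HubbardSuperconductivity.HubbardSuperconductivity.Theorems.KLProgrammeKLRegimeEnginePairTransferOutClassFrameShift
import Summits.HubbardSuperconductivity.HubbardSuperconductivity.Theorems.KLProgrammeKLRegimeEngineV8DefsHshiftC
import Summits.HubbardSuperconductivity.HubbardSuperconductivity.Theorems.KLProgrammeKLRegimeEnginePairTransferOutClassFrameShiftOrders

/-!
# Route `KLProgramme` — ENGINE item stmt-HubbardSuperconductivity-20437 `KLRegimeEngineV17F2`, located item «(c)-HSHIFT-4LEG»: the `hshift` binder of the (c) out-of-class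
# assembly FROM A FRAME-LIPSCHITZ RESPONSE AT THE NAMED NUMERAL `klHshiftC`, with the U-door DISCHARGED below `klEngU₀4` (cell gate-hubbard-kl, seat hubbard-kl-k3c2-p2 g21)

WHY.  `hshift_of_frameResponse(_hist)` (…PairTransferOutClassFrameShift, this seat) turns `‖𝒜ₙ[Kₙ] − 𝒜ₙ[Kₙ₋₁]‖ ≤ ℓ·frameDist Kₙ Kₙ₋₁` with `ℓ ≤ cℓ·(Klam U)²/Λₙ`
into the `hshift` binder `≤ frameShiftBar P Q U n` of `outClass_hout_le_bars_klEngGeo14_of_shares`, under the U-door `512·cℓ·Gfr₀·|U| ≤ Q.CR`.  p2 g23 named the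
numeral `klHshiftC = 2⁹⁶` (…EngineV8DefsHshiftC) and proved the door NEVER BINDS below `klEngU₀4` (`hshift_door_klHshiftC_of_le_klEngU₀4`, any raise `Q` of
`klEngQ8 P R`; pen (R281): the U-entry is OMITTED from the render).  This file composes the two: the (c) closer's `hshift` now costs exactly the analytic
response `hresp` + its pricing `hℓ : ℓ ≤ klHshiftC·(Klam U)²/Λₙ` (located-risk #6, E-lineage) — no U-smallness beyond `U ≤ klEngU₀4 P R c`.
* **`hshift_of_frameResponse_klHshiftC`** — abstract amplitudes `a b`, frames `K₁ K₀` with the (I-F) jets distance, any raise `Q` of `klEngQ8 P R`;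
* **`hshift_of_frameResponse_hist_klHshiftC`** — the pair amplitudes along the flow frames from `HistP klPredsV17F2 … 0 n`, any raise `Q`;
* **`hshift_of_frameResponse_hist_klEngQ9c`** — at the registered (c) package `klEngQ9c P R` (`isRaiseOf_klEngQ9c_klEngQ8`).
Pure composition; nothing about the model's response `ℓ` is asserted; nothing asserts (c), (C), K3 or superconductivity.  0 kit · 0 lit.
-/

noncomputable section

namespace Summit.HubbardSuperconductivity.HubbardSuperconductivity.Theorems.KLRegimeSplit

set_option linter.dupNamespace false -- summit = problem name (single-conjunct summit), D-0017

open Real Finset Literature.MathematicalPhysics.QuantumLattice Literature.Probability.LatticeModels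
open Summit.HubbardSuperconductivity.HubbardSuperconductivity.Theorems.KLProgrammeLegKernels
open Summit.HubbardSuperconductivity.HubbardSuperconductivity.Theorems.EngineV8

/-- **`hshift` at `klHshiftC`, abstract form**: `‖a − b‖ ≤ ℓ·frameDist K₁ K₀`, `ℓ ≤ klHshiftC·(KlamU)²/Λₙ₊₁`, the (I-F) jets distance `frameDist K₁ K₀ ≤ Gfr₀·uPow 0 U·4^{−2n}`,
`R.WF`, `Q` a raise of `klEngQ8 P R`, `0 < U ≤ klEngU₀4 P R c` ⇒ `‖a − b‖ ≤ frameShiftBar P Q U (n+1)`. -/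
theorem hshift_of_frameResponse_klHshiftC {P : SplitConsts} {Q : EngConsts} {R : RenConsts} {U c : ℝ} {a b : ℂ} {ℓ : ℝ} {K₁ K₀ : TrigPolyC4v} (n : ℕ)
    (hR : R.WF) (hQ : (klEngQ8 P R).IsRaiseOf Q) (hU : 0 < U) (hUle : U ≤ klEngU₀4 P R c)
    (hresp : ‖a - b‖ ≤ ℓ * frameDist K₁ K₀) (hℓ : ℓ ≤ klHshiftC * (P.Klam * U) ^ 2 / klScale klE0 (n + 1))
    (hdist : frameDist K₁ K₀ ≤ R.Gfr 0 * uPow 0 U * (4 : ℝ) ^ ((((0 : ℕ) : ℤ) - 2) * (n : ℤ))) :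
    ‖a - b‖ ≤ frameShiftBar P Q U (n + 1) :=
  hshift_of_frameResponse (P := P) (Q := Q) n hresp hℓ hdist (hR.2.2 0) klHshiftC_nonneg (hshift_door_klHshiftC_of_le_klEngU₀4 hR hQ hU hUle)

section Model

variable {L M : ℕ} [NeZero L] [NeZero M] {G : GeoConsts} {P : SplitConsts} {Q : EngConsts} {R : RenConsts} {β U μ : ℝ} {n : ℕ}

/-- **`hshift` at `klHshiftC` along the flow frames**: from the history `HistP klPredsV17F2 … 0 n` (`1 ≤ n`; the jets give `frameDist Kₙ Kₙ₋₁`), `R.WF`, `Q` a raise of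
`klEngQ8 P R`, `0 < U ≤ klEngU₀4 P R c`, a frame-Lipschitz response of the scale-`n` pair amplitude with `ℓ ≤ klHshiftC·(KlamU)²/Λₙ` ⇒ the `hshift` binder. -/
theorem hshift_of_frameResponse_hist_klHshiftC (hhist : HistP klPredsV17F2 L M G P Q R β U μ 0 n) (hn1 : 1 ≤ n) (hR : R.WF)
    (hQ : (klEngQ8 P R).IsRaiseOf Q) {c : ℝ} (hU : 0 < U) (hUle : U ≤ klEngU₀4 P R c) {ℓ : ℝ} {Qm x y : TorusSite 2 L}
    (hresp : ‖klPairAmplitude L M β U μ (klFlowFrameU L M β U μ n) n Qm x y - klPairAmplitude L M β U μ (klFlowFrameU L M β U μ (n - 1)) n Qm x y‖ ≤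
      ℓ * frameDist (klFlowFrameU L M β U μ n) (klFlowFrameU L M β U μ (n - 1)))
    (hℓ : ℓ ≤ klHshiftC * (P.Klam * U) ^ 2 / klScale klE0 n) :
    ‖klPairAmplitude L M β U μ (klFlowFrameU L M β U μ n) n Qm x y - klPairAmplitude L M β U μ (klFlowFrameU L M β U μ (n - 1)) n Qm x y‖ ≤
      frameShiftBar P Q U n :=
  hshift_of_frameResponse_hist hhist hn1 (hR.2.2 0) klHshiftC_nonneg hresp hℓ (hshift_door_klHshiftC_of_le_klEngU₀4 hR hQ hU hUle)

/-- **`hshift` at `klHshiftC` along the flow frames, at the registered (c) package `klEngQ9c P R`** (`isRaiseOf_klEngQ9c_klEngQ8`). -/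
theorem hshift_of_frameResponse_hist_klEngQ9c (hhist : HistP klPredsV17F2 L M G P (klEngQ9c P R) R β U μ 0 n) (hn1 : 1 ≤ n) (hR : R.WF)
    {c : ℝ} (hU : 0 < U) (hUle : U ≤ klEngU₀4 P R c) {ℓ : ℝ} {Qm x y : TorusSite 2 L}
    (hresp : ‖klPairAmplitude L M β U μ (klFlowFrameU L M β U μ n) n Qm x y - klPairAmplitude L M β U μ (klFlowFrameU L M β U μ (n - 1)) n Qm x y‖ ≤
      ℓ * frameDist (klFlowFrameU L M β U μ n) (klFlowFrameU L M β U μ (n - 1)))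
    (hℓ : ℓ ≤ klHshiftC * (P.Klam * U) ^ 2 / klScale klE0 n) :
    ‖klPairAmplitude L M β U μ (klFlowFrameU L M β U μ n) n Qm x y - klPairAmplitude L M β U μ (klFlowFrameU L M β U μ (n - 1)) n Qm x y‖ ≤
      frameShiftBar P (klEngQ9c P R) U n :=
  hshift_of_frameResponse_hist_klHshiftC hhist hn1 hR (isRaiseOf_klEngQ9c_klEngQ8 P R) hU hUle hresp hℓ

end Model

/-! ## §A (append, g21 22:40Z) The two-orders form with BOTH doors discharged -/

section ModelOrders

variable {L M : ℕ} [NeZero L] [NeZero M] {G : GeoConsts} {P : SplitConsts} {Q : EngConsts} {R : RenConsts} {β U μ : ℝ} {n : ℕ}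

/-- **`hshift` from a TWO-ORDERS frame response with both doors discharged** (p2 g24's `hshift_of_frameResponse_orders_hist` + `hshift_door_order1_of_le` +
`hshift_door_order2_klHshiftC_of_le_klEngU₀4`): a response `(ℓ₁ + ℓ₂)·frameDist` with `ℓ₁ ≤ cℓ₁·Klam|U|/Λₙ`, `cℓ₁ ≤ 2⁴⁰`, and `ℓ₂ ≤ klHshiftC·(KlamU)²/Λₙ`, at any
raise `Q` of `klEngQ8 P R`, under `P.WF`, `R.WF`, `0 < U ≤ klEngU₀4 P R c` ⇒ the `hshift` binder `≤ frameShiftBar P Q U n` — no U-table entry. -/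
theorem hshift_of_frameResponse_orders_hist_discharged (hhist : HistP klPredsV17F2 L M G P Q R β U μ 0 n) (hn1 : 1 ≤ n) (hP : P.WF) (hR : R.WF)
    (hQ : (klEngQ8 P R).IsRaiseOf Q) {c : ℝ} (hU : 0 < U) (hUle : U ≤ klEngU₀4 P R c) {ℓ₁ ℓ₂ cℓ₁ : ℝ} (hcℓ₁ : 0 ≤ cℓ₁) (hcℓ₁' : cℓ₁ ≤ 2 ^ 40)
    {Qm x y : TorusSite 2 L}
    (hresp : ‖klPairAmplitude L M β U μ (klFlowFrameU L M β U μ n) n Qm x y - klPairAmplitude L M β U μ (klFlowFrameU L M β U μ (n - 1)) n Qm x y‖ ≤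
      (ℓ₁ + ℓ₂) * frameDist (klFlowFrameU L M β U μ n) (klFlowFrameU L M β U μ (n - 1)))
    (hℓ₁ : ℓ₁ ≤ cℓ₁ * (P.Klam * |U|) / klScale klE0 n) (hℓ₂ : ℓ₂ ≤ klHshiftC * (P.Klam * U) ^ 2 / klScale klE0 n) :
    ‖klPairAmplitude L M β U μ (klFlowFrameU L M β U μ n) n Qm x y - klPairAmplitude L M β U μ (klFlowFrameU L M β U μ (n - 1)) n Qm x y‖ ≤
      frameShiftBar P Q U n :=
  hshift_of_frameResponse_orders_hist hhist hn1 (hR.2.2 0) (zero_le_one.trans hP.1) hcℓ₁ klHshiftC_nonneg hresp hℓ₁ hℓ₂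
    (hshift_door_order1_of_le hP hR hQ hcℓ₁') (hshift_door_order2_klHshiftC_of_le_klEngU₀4 hR hQ hU hUle)

/-- The same at the registered (c) package `klEngQ9c P R`. -/
theorem hshift_of_frameResponse_orders_hist_klEngQ9c (hhist : HistP klPredsV17F2 L M G P (klEngQ9c P R) R β U μ 0 n) (hn1 : 1 ≤ n) (hP : P.WF) (hR : R.WF)
    {c : ℝ} (hU : 0 < U) (hUle : U ≤ klEngU₀4 P R c) {ℓ₁ ℓ₂ cℓ₁ : ℝ} (hcℓ₁ : 0 ≤ cℓ₁) (hcℓ₁' : cℓ₁ ≤ 2 ^ 40) {Qm x y : TorusSite 2 L}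
    (hresp : ‖klPairAmplitude L M β U μ (klFlowFrameU L M β U μ n) n Qm x y - klPairAmplitude L M β U μ (klFlowFrameU L M β U μ (n - 1)) n Qm x y‖ ≤
      (ℓ₁ + ℓ₂) * frameDist (klFlowFrameU L M β U μ n) (klFlowFrameU L M β U μ (n - 1)))
    (hℓ₁ : ℓ₁ ≤ cℓ₁ * (P.Klam * |U|) / klScale klE0 n) (hℓ₂ : ℓ₂ ≤ klHshiftC * (P.Klam * U) ^ 2 / klScale klE0 n) :
    ‖klPairAmplitude L M β U μ (klFlowFrameU L M β U μ n) n Qm x y - klPairAmplitude L M β U μ (klFlowFrameU L M β U μ (n - 1)) n Qm x y‖ ≤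
      frameShiftBar P (klEngQ9c P R) U n :=
  hshift_of_frameResponse_orders_hist_discharged hhist hn1 hP hR (isRaiseOf_klEngQ9c_klEngQ8 P R) hU hUle hcℓ₁ hcℓ₁' hresp hℓ₁ hℓ₂

end ModelOrders

end Summit.HubbardSuperconductivity.HubbardSuperconductivity.Theorems.KLRegimeSplit

end
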